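import Literature.NumberTheory.Automorphic.AutomorphicRepsGLCuspidalL2Step2
import Literature.NumberTheory.Automorphic.HarishChandraL2GL
import HarnessLib

/-!
# Step 2 of Borel–Jacquet 4.6 for `GL_n` from Harish-Chandra's convolution identity alone

Topic `NumberTheory/Automorphic`. The named fact
`AutomorphicRepsGL.formsOfL2_isStableSubmodule hcpt μ` (`AutomorphicRepsGLCuspidalL2`: for an
irreducible closed invariant `Π ≤ L²_cusp(GL_n(𝔸_K) ⧸ A_G GL_n(K), μ)` the space `V_Π` of
automorphic forms `g ↦ f [g⁻¹]`, `[f] ∈ Π`, is `(𝔤, K_∞) × GL_n(𝔸_K^∞)`-stable) was reduced in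
`AutomorphicRepsGLCuspidalL2Step2` to two Harish-Chandra inputs, the moderate growth of Lie
derivatives of automorphic forms (`AutomorphicRepsGL.hasModerateGrowth_lieDeriv`) and the `L²`
side (`AutomorphicRepsGL.exists_toLp_mem_invQuot_eq_lieDeriv`). Both are theorems granted the
single named fact `AutomorphicRepsGL.exists_convolution_eq_self hcpt` (Harish-Chandra's
`φ = φ ∗ α`, `HarishChandraConvolutionGL`): `hasModerateGrowth_lieDeriv_of_convolution`
(`HarishChandraGrowthGL`) and `exists_toLp_mem_invQuot_eq_lieDeriv_of_convolution`
(`HarishChandraL2GL`). This file records the resulting discharges: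

* `AutomorphicRepsGL.hasModerateGrowth_lieDeriv_of_HC`,
  `AutomorphicRepsGL.exists_toLp_mem_invQuot_eq_lieDeriv_of_HC`,
  `AutomorphicRepsGL.formsOfL2_lie_stable_of_HC`;
* `AutomorphicRepsGL.formsOfL2_isStableSubmodule_of_harishChandra` :
  `exists_convolution_eq_self hcpt → formsOfL2_isStableSubmodule hcpt μ` — **Step 2 of
  Borel–Jacquet 4.6 for `GL_n` rests on Harish-Chandra's convolution identity alone**;
* `AutomorphicRepsGL.exists_cuspidalRepData_of_L2_of_harishChandra` : F1 (`formsOfL2_ne_bot`) →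
  `exists_convolution_eq_self` → F3 (`formsOfL2_irreducible`) → `exists_cuspidalRepData_of_L2`.

Everything here is proved.

## References

* A. Borel, H. Jacquet, *Automorphic forms and automorphic representations*, Proc. Sympos. Pure
  Math. 33 (1979), part 1, 4.3 (ii) and 4.6 [BorelJacquet1979].
* A. Borel, *Représentations de groupes localement compacts*, LNM 276 (1972), Thm. 3.18,
  Cor. 3.19–3.21 [Borel1972].
-/

noncomputable section

open scoped MatrixGroups
open MeasureTheory NumberField NumberField.mixedEmbedding IsDedekindDomain

namespace Literature.NumberTheory.Automorphic

variable {n : ℕ} {K : Type} [Field K] [NumberField K]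
  {hcpt : isCompact_glFiniteIntegralLevel n K}

/-- **Fact 1 of Step 2 from Harish-Chandra's convolution identity**: Lie derivatives of
automorphic forms on `GL_n(𝔸_K)` have moderate growth (`hasModerateGrowth_lieDeriv_of_convolution`).
Borel–Jacquet 1979, 4.3 (ii). [cite: BorelJacquet1979, 4.3 (ii)] -/
theorem AutomorphicRepsGL.hasModerateGrowth_lieDeriv_of_HC
    (hHC : AutomorphicRepsGL.exists_convolution_eq_self hcpt) :
    AutomorphicRepsGL.hasModerateGrowth_lieDeriv hcpt :=
  fun _ hφ X => hasModerateGrowth_lieDeriv_of_convolution hHC hφ X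

variable {μ : Measure (AdelicGroupData.gl n K).automorphicQuotient}
  [(AdelicGroupData.gl n K).IsAutomorphicMeasure μ]

/-- **Fact 2 of Step 2 from Harish-Chandra's convolution identity**: Lie derivatives of the
automorphic forms of a closed invariant `Π ≤ L²(μ)` represent vectors of `Π`
(`exists_toLp_mem_invQuot_eq_lieDeriv_of_convolution`). Borel 1972, Cor. 3.19–3.21;
Borel–Jacquet 1979, 4.6. [cite: BorelJacquet1979, 4.6] -/
theorem AutomorphicRepsGL.exists_toLp_mem_invQuot_eq_lieDeriv_of_HC
    (hHC : AutomorphicRepsGL.exists_convolution_eq_self hcpt) :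
    AutomorphicRepsGL.exists_toLp_mem_invQuot_eq_lieDeriv hcpt μ :=
  fun P f hf hfP hφ X => exists_toLp_mem_invQuot_eq_lieDeriv_of_convolution hcpt μ hHC P f hf hfP hφ X

/-- **The Lie algebra part of Step 2 from Harish-Chandra's convolution identity.**
Borel–Jacquet 1979, 4.3 (ii) and 4.6. [cite: BorelJacquet1979, 4.6] -/
theorem AutomorphicRepsGL.formsOfL2_lie_stable_of_HC
    (hHC : AutomorphicRepsGL.exists_convolution_eq_self hcpt) :
    AutomorphicRepsGL.formsOfL2_lie_stable hcpt μ :=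
  AutomorphicRepsGL.formsOfL2_lie_stable_of (AutomorphicRepsGL.hasModerateGrowth_lieDeriv_of_HC hHC)
    (AutomorphicRepsGL.exists_toLp_mem_invQuot_eq_lieDeriv_of_HC hHC)

/-- **Step 2 of Borel–Jacquet 4.6 for `GL_n` rests on Harish-Chandra's convolution identity
alone**: `exists_convolution_eq_self hcpt → formsOfL2_isStableSubmodule hcpt μ`. For an
irreducible closed invariant `Π ≤ L²_cusp`, `V_Π ≤ 𝒜` is stable under `GL_n(𝔸_K^∞)`
(`formsOfL2_finite_stable`), `K_∞` (`formsOfL2_k_stable`) and `𝔤`: `X φ` is an automorphic form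
(smoothness, `K_∞`- and `Z(𝔤)`-finiteness proved; moderate growth from `X φ = φ ∗ α_X`) whose class
`∫ α_X(x) Π(x, 1) [f] dx` lies in `Π`. Borel–Jacquet 1979, 4.3 (ii) and 4.6; Borel 1972, Thm. 3.18,
Cor. 3.19–3.21. [cite: BorelJacquet1979, 4.6] -/
theorem AutomorphicRepsGL.formsOfL2_isStableSubmodule_of_harishChandra
    (hHC : AutomorphicRepsGL.exists_convolution_eq_self hcpt) :
    AutomorphicRepsGL.formsOfL2_isStableSubmodule hcpt μ :=
  AutomorphicRepsGL.formsOfL2_isStableSubmodule_of (AutomorphicRepsGL.hasModerateGrowth_lieDeriv_of_HC hHC)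
    (AutomorphicRepsGL.exists_toLp_mem_invQuot_eq_lieDeriv_of_HC hHC)

/-- **Borel–Jacquet 4.6 for `GL_n` from F1, Harish-Chandra's convolution identity, and F3.**
[cite: BorelJacquet1979, 4.6] -/
theorem AutomorphicRepsGL.exists_cuspidalRepData_of_L2_of_harishChandra
    (h₁ : AutomorphicRepsGL.formsOfL2_ne_bot hcpt μ)
    (hHC : AutomorphicRepsGL.exists_convolution_eq_self hcpt)
    (h₃ : AutomorphicRepsGL.formsOfL2_irreducible hcpt μ) :
    AutomorphicRepsGL.exists_cuspidalRepData_of_L2 hcpt μ :=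
  AutomorphicRepsGL.exists_cuspidalRepData_of_L2_of_HC h₁
    (AutomorphicRepsGL.formsOfL2_lie_stable_of_HC hHC) h₃

end Literature.NumberTheory.Automorphic
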